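import Summits.NavierStokesRegularity.NavierStokesRegularity.Theorems.TypeICertificateLadderLadderGlueIff

/-!
# NavierStokesRegularity — route `TypeICertificateLadder`: the shapes of `DescentToRungOne`

Support lemmas for item stmt-NavierStokesRegularity-14842 (`Theses.TypeICertificateLadder.DescentToRungOne`:
for every `C ≥ 1`, a classical solution of unforced Navier–Stokes on `ℝ³ × [0, T)` that is
Leray–Hopf from a rapidly decaying datum, has eventual dimensionless rate `√(T − t)‖u(t, x)‖ ≤ C√ν`
and does NOT extend smoothly past `T`, eventually satisfies `√(T − t)‖u(t, x)‖ ≤ √ν`). Every route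
Prop is expanded verbatim and no `Theses` file is imported (pattern of
`Theorems/TypeICertificateLadderLadderGlueIff.lean` and `…RungOneSplice.lean`), so the file can be
imported by a future closing proof and by the route file.

The exact split `NoTypeIBlowup ↔ RungReynoldsOne ∧ DescentToRungOne` is already in the tree
(`typeICertificateLadder_noTypeIBlowup_iff_rungOne_and_descent`, `…RungOneSplice.lean`). Recorded
here (pure bookkeeping, no analysis):

* `typeICertificateLadder_descent_of_noTypeIBlowup` — the named one-line closer of stmt-14842 from the
  crux `NoTypeIBlowup` (stmt-NavierStokesRegularity-1217): the descent holds VACUOUSLY under the crux.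
* `typeICertificateLadder_rung_of_rungOne_of_descentLevel` — a descent MILESTONE at a single level
  `C₁` (Type-I(C₁) singular ⇒ eventually Type-I(1)) upgrades rung one (`RungReynoldsOne`, stmt-2882)
  to the exclusion rung `X_{C₁}`: this is how per-level milestones `C₁ = 2, 5, 10, …` feed the ladder;
  conversely `typeICertificateLadder_descentLevel_of_rung` (a rung gives its milestone vacuously), so
  `typeICertificateLadder_descentLevel_iff_rung_of_rungOne`: given rung one, milestone `C₁` ↔ rung
  `X_{C₁}` level by level — the item is not easier than the rungs it replaces.
* `typeICertificateLadder_noTypeIBlowup_of_rung_of_descent` — an exclusion rung at ANY level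
  `C₀ ≥ 1` (e.g. the reach `C₀ < √6 − √2` of the `L^q`-vorticity budget,
  `Theorems/RungReynoldsOne/Negative/BudgetCeiling.lean`) plus the full descent gives the crux.
* `typeICertificateLadder_descentLevel_mono`, `typeICertificateLadder_descent_iff_natLevels`,
  `typeICertificateLadder_descent_iff_halving` — milestones are nested in the level, the integer
  levels `C₁ = n + 1` exhaust the item, and the item is equivalent to the rung-by-rung HALVING form
  `D_C` (Type-I(2C) singular ⇒ eventually Type-I(C), `C ≥ 1`) by iteration over dyadic levels.
-/

namespace Summit.NavierStokesRegularity.NavierStokesRegularity.Theorems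

open Filter Topology

/-- **The crux gives the descent vacuously** (route `TypeICertificateLadder`): `NoTypeIBlowup`
(stmt-NavierStokesRegularity-1217, expanded verbatim) implies `DescentToRungOne`
(stmt-NavierStokesRegularity-14842, expanded verbatim) — under the crux every Type-I(C) classical
Leray–Hopf rapidly-decaying-datum solution extends past `T`
(`typeICertificateLadder_rung_of_noTypeIBlowup`), so the non-extension hypothesis is absurd. Equal to
the second component of `typeICertificateLadder_noTypeIBlowup_iff_rungOne_and_descent`
(`…RungOneSplice.lean`), named here as the one-line closer of the item once the crux lands.
[bookkeeping] -/
theorem typeICertificateLadder_descent_of_noTypeIBlowup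
    (hI : ∀ (ν T : ℝ), 0 < ν → 0 < T → ∀ (u : ℝ → EuclideanSpace ℝ (Fin 3) → EuclideanSpace ℝ (Fin 3)) (p : ℝ → EuclideanSpace ℝ (Fin 3) → ℝ), Literature.Analysis.FluidPDE.IsClassicalNSSolutionOn (Set.Ico 0 T) ν 0 u p → Literature.Analysis.FluidPDE.IsLerayHopfOn T ν 0 (u 0) u → Literature.Analysis.FluidPDE.HasRapidSpatialDecay (u 0) → Literature.Analysis.FluidPDE.IsTypeIBlowup u T → Literature.Analysis.FluidPDE.HasSmoothExtensionPast ν 0 u T) :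
    ∀ C : ℝ, 1 ≤ C → ∀ (ν T : ℝ), 0 < ν → 0 < T → ∀ (u : ℝ → EuclideanSpace ℝ (Fin 3) → EuclideanSpace ℝ (Fin 3)) (p : ℝ → EuclideanSpace ℝ (Fin 3) → ℝ), Literature.Analysis.FluidPDE.IsClassicalNSSolutionOn (Set.Ico 0 T) ν 0 u p → Literature.Analysis.FluidPDE.IsLerayHopfOn T ν 0 (u 0) u → Literature.Analysis.FluidPDE.HasRapidSpatialDecay (u 0) → (∀ᶠ t in 𝓝[<] T, ∀ x, Real.sqrt (T - t) * ‖u t x‖ ≤ C * Real.sqrt ν) → ¬ Literature.Analysis.FluidPDE.HasSmoothExtensionPast ν 0 u T → ∀ᶠ t in 𝓝[<] T, ∀ x, Real.sqrt (T - t) * ‖u t x‖ ≤ Real.sqrt ν :=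
  fun C _ ν T hν hT u p hcl hLH hdec hrate hne =>
    absurd (typeICertificateLadder_rung_of_noTypeIBlowup hI C ν T hν hT u p hcl hLH hdec hrate) hne

/-- **A descent milestone upgrades rung one** (route `TypeICertificateLadder`): if rung one holds
(`RungReynoldsOne`, stmt-NavierStokesRegularity-2882, expanded verbatim: eventual rate
`√(T − t)‖u‖ ≤ √ν` ⇒ extension) and the descent milestone at the single level `C₁` holds (a
Type-I(C₁) solution that does not extend eventually has rate `≤ √ν`), then the exclusion rung
`X_{C₁}` holds: a Type-I(C₁) solution that did not extend would descend to rate `≤ √ν` and then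
extend by rung one. [bookkeeping] -/
theorem typeICertificateLadder_rung_of_rungOne_of_descentLevel {C₁ : ℝ}
    (h1 : ∀ (ν T : ℝ), 0 < ν → 0 < T → ∀ (u : ℝ → EuclideanSpace ℝ (Fin 3) → EuclideanSpace ℝ (Fin 3)) (p : ℝ → EuclideanSpace ℝ (Fin 3) → ℝ), Literature.Analysis.FluidPDE.IsClassicalNSSolutionOn (Set.Ico 0 T) ν 0 u p → Literature.Analysis.FluidPDE.IsLerayHopfOn T ν 0 (u 0) u → Literature.Analysis.FluidPDE.HasRapidSpatialDecay (u 0) → (∀ᶠ t in 𝓝[<] T, ∀ x, Real.sqrt (T - t) * ‖u t x‖ ≤ Real.sqrt ν) → Literature.Analysis.FluidPDE.HasSmoothExtensionPast ν 0 u T)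
    (hD : ∀ (ν T : ℝ), 0 < ν → 0 < T → ∀ (u : ℝ → EuclideanSpace ℝ (Fin 3) → EuclideanSpace ℝ (Fin 3)) (p : ℝ → EuclideanSpace ℝ (Fin 3) → ℝ), Literature.Analysis.FluidPDE.IsClassicalNSSolutionOn (Set.Ico 0 T) ν 0 u p → Literature.Analysis.FluidPDE.IsLerayHopfOn T ν 0 (u 0) u → Literature.Analysis.FluidPDE.HasRapidSpatialDecay (u 0) → (∀ᶠ t in 𝓝[<] T, ∀ x, Real.sqrt (T - t) * ‖u t x‖ ≤ C₁ * Real.sqrt ν) → ¬ Literature.Analysis.FluidPDE.HasSmoothExtensionPast ν 0 u T → ∀ᶠ t in 𝓝[<] T, ∀ x, Real.sqrt (T - t) * ‖u t x‖ ≤ Real.sqrt ν) :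
    ∀ (ν T : ℝ), 0 < ν → 0 < T → ∀ (u : ℝ → EuclideanSpace ℝ (Fin 3) → EuclideanSpace ℝ (Fin 3)) (p : ℝ → EuclideanSpace ℝ (Fin 3) → ℝ), Literature.Analysis.FluidPDE.IsClassicalNSSolutionOn (Set.Ico 0 T) ν 0 u p → Literature.Analysis.FluidPDE.IsLerayHopfOn T ν 0 (u 0) u → Literature.Analysis.FluidPDE.HasRapidSpatialDecay (u 0) → (∀ᶠ t in 𝓝[<] T, ∀ x, Real.sqrt (T - t) * ‖u t x‖ ≤ C₁ * Real.sqrt ν) → Literature.Analysis.FluidPDE.HasSmoothExtensionPast ν 0 u T := by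
  intro ν T hν hT u p hcl hLH hdec hrate
  by_contra hne
  exact hne (h1 ν T hν hT u p hcl hLH hdec (hD ν T hν hT u p hcl hLH hdec hrate hne))

/-- **Exclusion rungs give descent milestones vacuously** (route `TypeICertificateLadder`): the
exclusion rung `X_{C₁}` implies the descent milestone at level `C₁` (under `X_{C₁}` no Type-I(C₁)
solution fails to extend) — per level the milestone is the weaker statement. [bookkeeping] -/
theorem typeICertificateLadder_descentLevel_of_rung {C₁ : ℝ}
    (hX : ∀ (ν T : ℝ), 0 < ν → 0 < T → ∀ (u : ℝ → EuclideanSpace ℝ (Fin 3) → EuclideanSpace ℝ (Fin 3)) (p : ℝ → EuclideanSpace ℝ (Fin 3) → ℝ), Literature.Analysis.FluidPDE.IsClassicalNSSolutionOn (Set.Ico 0 T) ν 0 u p → Literature.Analysis.FluidPDE.IsLerayHopfOn T ν 0 (u 0) u → Literature.Analysis.FluidPDE.HasRapidSpatialDecay (u 0) → (∀ᶠ t in 𝓝[<] T, ∀ x, Real.sqrt (T - t) * ‖u t x‖ ≤ C₁ * Real.sqrt ν) → Literature.Analysis.FluidPDE.HasSmoothExtensionPast ν 0 u T) :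
    ∀ (ν T : ℝ), 0 < ν → 0 < T → ∀ (u : ℝ → EuclideanSpace ℝ (Fin 3) → EuclideanSpace ℝ (Fin 3)) (p : ℝ → EuclideanSpace ℝ (Fin 3) → ℝ), Literature.Analysis.FluidPDE.IsClassicalNSSolutionOn (Set.Ico 0 T) ν 0 u p → Literature.Analysis.FluidPDE.IsLerayHopfOn T ν 0 (u 0) u → Literature.Analysis.FluidPDE.HasRapidSpatialDecay (u 0) → (∀ᶠ t in 𝓝[<] T, ∀ x, Real.sqrt (T - t) * ‖u t x‖ ≤ C₁ * Real.sqrt ν) → ¬ Literature.Analysis.FluidPDE.HasSmoothExtensionPast ν 0 u T → ∀ᶠ t in 𝓝[<] T, ∀ x, Real.sqrt (T - t) * ‖u t x‖ ≤ Real.sqrt ν :=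
  fun ν T hν hT u p hcl hLH hdec hrate hne => absurd (hX ν T hν hT u p hcl hLH hdec hrate) hne

/-- **Given rung one, milestone = rung, level by level** (route `TypeICertificateLadder`): under
`RungReynoldsOne` (stmt-NavierStokesRegularity-2882, expanded verbatim) the descent milestone at
level `C₁` is EQUIVALENT to the exclusion rung `X_{C₁}`
(`typeICertificateLadder_rung_of_rungOne_of_descentLevel`,
`typeICertificateLadder_descentLevel_of_rung`): once rung one is in, landing a milestone at
`C₁ = 2, 5, 10, …` is the same as landing that rung. [bookkeeping] -/
theorem typeICertificateLadder_descentLevel_iff_rung_of_rungOne {C₁ : ℝ}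
    (h1 : ∀ (ν T : ℝ), 0 < ν → 0 < T → ∀ (u : ℝ → EuclideanSpace ℝ (Fin 3) → EuclideanSpace ℝ (Fin 3)) (p : ℝ → EuclideanSpace ℝ (Fin 3) → ℝ), Literature.Analysis.FluidPDE.IsClassicalNSSolutionOn (Set.Ico 0 T) ν 0 u p → Literature.Analysis.FluidPDE.IsLerayHopfOn T ν 0 (u 0) u → Literature.Analysis.FluidPDE.HasRapidSpatialDecay (u 0) → (∀ᶠ t in 𝓝[<] T, ∀ x, Real.sqrt (T - t) * ‖u t x‖ ≤ Real.sqrt ν) → Literature.Analysis.FluidPDE.HasSmoothExtensionPast ν 0 u T) :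
    (∀ (ν T : ℝ), 0 < ν → 0 < T → ∀ (u : ℝ → EuclideanSpace ℝ (Fin 3) → EuclideanSpace ℝ (Fin 3)) (p : ℝ → EuclideanSpace ℝ (Fin 3) → ℝ), Literature.Analysis.FluidPDE.IsClassicalNSSolutionOn (Set.Ico 0 T) ν 0 u p → Literature.Analysis.FluidPDE.IsLerayHopfOn T ν 0 (u 0) u → Literature.Analysis.FluidPDE.HasRapidSpatialDecay (u 0) → (∀ᶠ t in 𝓝[<] T, ∀ x, Real.sqrt (T - t) * ‖u t x‖ ≤ C₁ * Real.sqrt ν) → ¬ Literature.Analysis.FluidPDE.HasSmoothExtensionPast ν 0 u T → ∀ᶠ t in 𝓝[<] T, ∀ x, Real.sqrt (T - t) * ‖u t x‖ ≤ Real.sqrt ν) ↔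
    ∀ (ν T : ℝ), 0 < ν → 0 < T → ∀ (u : ℝ → EuclideanSpace ℝ (Fin 3) → EuclideanSpace ℝ (Fin 3)) (p : ℝ → EuclideanSpace ℝ (Fin 3) → ℝ), Literature.Analysis.FluidPDE.IsClassicalNSSolutionOn (Set.Ico 0 T) ν 0 u p → Literature.Analysis.FluidPDE.IsLerayHopfOn T ν 0 (u 0) u → Literature.Analysis.FluidPDE.HasRapidSpatialDecay (u 0) → (∀ᶠ t in 𝓝[<] T, ∀ x, Real.sqrt (T - t) * ‖u t x‖ ≤ C₁ * Real.sqrt ν) → Literature.Analysis.FluidPDE.HasSmoothExtensionPast ν 0 u T :=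
  ⟨typeICertificateLadder_rung_of_rungOne_of_descentLevel h1, typeICertificateLadder_descentLevel_of_rung⟩

/-- **An exclusion rung above level one plus descent gives the crux** (route
`TypeICertificateLadder`): if the exclusion rung `X_{C₀}` holds at some level `C₀ ≥ 1` and
`DescentToRungOne` holds (expanded verbatim), then `NoTypeIBlowup` holds (expanded verbatim). By
`typeICertificateLadder_ladderGlue_proof` it suffices to prove every rung `X_C`, `C > 0`: raise the
level to `max C 1 ≥ 1` (rungs are nested), descend to rate `≤ √ν ≤ C₀√ν`, and extend by `X_{C₀}`.
At `C₀ = 1` this is the rung-one splice (`typeICertificateLadder_rungOneSplice_proof`,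
stmt-NavierStokesRegularity-14843, `…RungOneSplice.lean`); levels `C₀ ∈ [1, √6 − √2)` are the reach
of the `L^q`-vorticity budget (`Theorems/RungReynoldsOne/Negative/BudgetCeiling.lean`).
[bookkeeping] -/
theorem typeICertificateLadder_noTypeIBlowup_of_rung_of_descent {C₀ : ℝ} (hC₀ : 1 ≤ C₀)
    (hX : ∀ (ν T : ℝ), 0 < ν → 0 < T → ∀ (u : ℝ → EuclideanSpace ℝ (Fin 3) → EuclideanSpace ℝ (Fin 3)) (p : ℝ → EuclideanSpace ℝ (Fin 3) → ℝ), Literature.Analysis.FluidPDE.IsClassicalNSSolutionOn (Set.Ico 0 T) ν 0 u p → Literature.Analysis.FluidPDE.IsLerayHopfOn T ν 0 (u 0) u → Literature.Analysis.FluidPDE.HasRapidSpatialDecay (u 0) → (∀ᶠ t in 𝓝[<] T, ∀ x, Real.sqrt (T - t) * ‖u t x‖ ≤ C₀ * Real.sqrt ν) → Literature.Analysis.FluidPDE.HasSmoothExtensionPast ν 0 u T)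
    (hD : ∀ C : ℝ, 1 ≤ C → ∀ (ν T : ℝ), 0 < ν → 0 < T → ∀ (u : ℝ → EuclideanSpace ℝ (Fin 3) → EuclideanSpace ℝ (Fin 3)) (p : ℝ → EuclideanSpace ℝ (Fin 3) → ℝ), Literature.Analysis.FluidPDE.IsClassicalNSSolutionOn (Set.Ico 0 T) ν 0 u p → Literature.Analysis.FluidPDE.IsLerayHopfOn T ν 0 (u 0) u → Literature.Analysis.FluidPDE.HasRapidSpatialDecay (u 0) → (∀ᶠ t in 𝓝[<] T, ∀ x, Real.sqrt (T - t) * ‖u t x‖ ≤ C * Real.sqrt ν) → ¬ Literature.Analysis.FluidPDE.HasSmoothExtensionPast ν 0 u T → ∀ᶠ t in 𝓝[<] T, ∀ x, Real.sqrt (T - t) * ‖u t x‖ ≤ Real.sqrt ν) :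
    ∀ (ν T : ℝ), 0 < ν → 0 < T → ∀ (u : ℝ → EuclideanSpace ℝ (Fin 3) → EuclideanSpace ℝ (Fin 3)) (p : ℝ → EuclideanSpace ℝ (Fin 3) → ℝ), Literature.Analysis.FluidPDE.IsClassicalNSSolutionOn (Set.Ico 0 T) ν 0 u p → Literature.Analysis.FluidPDE.IsLerayHopfOn T ν 0 (u 0) u → Literature.Analysis.FluidPDE.HasRapidSpatialDecay (u 0) → Literature.Analysis.FluidPDE.IsTypeIBlowup u T → Literature.Analysis.FluidPDE.HasSmoothExtensionPast ν 0 u T := by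
  refine typeICertificateLadder_ladderGlue_proof fun C _ ν T hν hT u p hcl hLH hdec hrate => ?_
  by_contra hne
  -- raise the level to `max C 1 ≥ 1` (rungs are nested)
  have hrate' : ∀ᶠ t in 𝓝[<] T, ∀ x, Real.sqrt (T - t) * ‖u t x‖ ≤ max C 1 * Real.sqrt ν := by
    filter_upwards [hrate] with t ht x
    exact (ht x).trans (mul_le_mul_of_nonneg_right (le_max_left _ _) (Real.sqrt_nonneg ν))
  -- descend to level one, then sit below level `C₀ ≥ 1` and extend
  have hdesc := hD (max C 1) (le_max_right _ _) ν T hν hT u p hcl hLH hdec hrate' hne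
  refine hne (hX ν T hν hT u p hcl hLH hdec ?_)
  filter_upwards [hdesc] with t ht x
  exact (ht x).trans (le_mul_of_one_le_left (Real.sqrt_nonneg ν) hC₀)

/-- **Descent milestones are nested in the level** (route `TypeICertificateLadder`): the milestone
at level `C₁` (Type-I(C₁) singular ⇒ eventually rate `≤ √ν`) implies the milestone at every level
`C₁' ≤ C₁`, a smaller rate bound being a stronger hypothesis on the solution. [bookkeeping] -/
theorem typeICertificateLadder_descentLevel_mono {C₁ C₁' : ℝ} (hC : C₁' ≤ C₁)
    (hD : ∀ (ν T : ℝ), 0 < ν → 0 < T → ∀ (u : ℝ → EuclideanSpace ℝ (Fin 3) → EuclideanSpace ℝ (Fin 3)) (p : ℝ → EuclideanSpace ℝ (Fin 3) → ℝ), Literature.Analysis.FluidPDE.IsClassicalNSSolutionOn (Set.Ico 0 T) ν 0 u p → Literature.Analysis.FluidPDE.IsLerayHopfOn T ν 0 (u 0) u → Literature.Analysis.FluidPDE.HasRapidSpatialDecay (u 0) → (∀ᶠ t in 𝓝[<] T, ∀ x, Real.sqrt (T - t) * ‖u t x‖ ≤ C₁ * Real.sqrt ν) → ¬ Literature.Analysis.FluidPDE.HasSmoothExtensionPast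 ν 0 u T → ∀ᶠ t in 𝓝[<] T, ∀ x, Real.sqrt (T - t) * ‖u t x‖ ≤ Real.sqrt ν) :
    ∀ (ν T : ℝ), 0 < ν → 0 < T → ∀ (u : ℝ → EuclideanSpace ℝ (Fin 3) → EuclideanSpace ℝ (Fin 3)) (p : ℝ → EuclideanSpace ℝ (Fin 3) → ℝ), Literature.Analysis.FluidPDE.IsClassicalNSSolutionOn (Set.Ico 0 T) ν 0 u p → Literature.Analysis.FluidPDE.IsLerayHopfOn T ν 0 (u 0) u → Literature.Analysis.FluidPDE.HasRapidSpatialDecay (u 0) → (∀ᶠ t in 𝓝[<] T, ∀ x, Real.sqrt (T - t) * ‖u t x‖ ≤ C₁' * Real.sqrt ν) → ¬ Literature.Analysis.FluidPDE.HasSmoothExtensionPast ν 0 u T → ∀ᶠ t in 𝓝[<] T, ∀ x, Real.sqrt (T - t) * ‖u t x‖ ≤ Real.sqrt ν := by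
  intro ν T hν hT u p hcl hLH hdec hrate hne
  refine hD ν T hν hT u p hcl hLH hdec ?_ hne
  filter_upwards [hrate] with t ht x
  exact (ht x).trans (mul_le_mul_of_nonneg_right hC (Real.sqrt_nonneg ν))

/-- **Integer milestones exhaust the descent** (route `TypeICertificateLadder`): `DescentToRungOne`
(expanded verbatim) holds iff the descent milestone holds at every integer level `C₁ = n + 1`,
`n : ℕ` (the level-`C` statement follows from the milestone at `⌈C⌉₊ + 1 ≥ C` by nesting). This is
the form in which per-level milestones (`C₁ = 2, 5, 10, …`) are meant to land. [bookkeeping] -/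
theorem typeICertificateLadder_descent_iff_natLevels :
    (∀ C : ℝ, 1 ≤ C → ∀ (ν T : ℝ), 0 < ν → 0 < T → ∀ (u : ℝ → EuclideanSpace ℝ (Fin 3) → EuclideanSpace ℝ (Fin 3)) (p : ℝ → EuclideanSpace ℝ (Fin 3) → ℝ), Literature.Analysis.FluidPDE.IsClassicalNSSolutionOn (Set.Ico 0 T) ν 0 u p → Literature.Analysis.FluidPDE.IsLerayHopfOn T ν 0 (u 0) u → Literature.Analysis.FluidPDE.HasRapidSpatialDecay (u 0) → (∀ᶠ t in 𝓝[<] T, ∀ x, Real.sqrt (T - t) * ‖u t x‖ ≤ C * Real.sqrt ν) → ¬ Literature.Analysis.FluidPDE.HasSmoothExtensionPast ν 0 u T → ∀ᶠ t in 𝓝[<] T, ∀ x, Real.sqrt (T - t) * ‖u t x‖ ≤ Real.sqrt ν) ↔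
    ∀ n : ℕ, ∀ (ν T : ℝ), 0 < ν → 0 < T → ∀ (u : ℝ → EuclideanSpace ℝ (Fin 3) → EuclideanSpace ℝ (Fin 3)) (p : ℝ → EuclideanSpace ℝ (Fin 3) → ℝ), Literature.Analysis.FluidPDE.IsClassicalNSSolutionOn (Set.Ico 0 T) ν 0 u p → Literature.Analysis.FluidPDE.IsLerayHopfOn T ν 0 (u 0) u → Literature.Analysis.FluidPDE.HasRapidSpatialDecay (u 0) → (∀ᶠ t in 𝓝[<] T, ∀ x, Real.sqrt (T - t) * ‖u t x‖ ≤ ((n : ℝ) + 1) * Real.sqrt ν) → ¬ Literature.Analysis.FluidPDE.HasSmoothExtensionPast ν 0 u T → ∀ᶠ t in 𝓝[<] T, ∀ x, Real.sqrt (T - t) * ‖u t x‖ ≤ Real.sqrt ν := by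
  constructor
  · intro hD n
    exact hD ((n : ℝ) + 1) (le_add_of_nonneg_left n.cast_nonneg)
  · intro hN C _
    -- the milestone at `⌈C⌉₊ + 1 ≥ C` covers level `C`
    exact typeICertificateLadder_descentLevel_mono
      (by exact_mod_cast (Nat.le_ceil C).trans (le_add_of_nonneg_right zero_le_one)) (hN ⌈C⌉₊)

/-- **The halving form** (route `TypeICertificateLadder`): `DescentToRungOne` (expanded verbatim) is
equivalent to the rung-by-rung halving statement `D_C`, `C ≥ 1`: a Type-I(2C) solution that does not
extend is eventually Type-I(C). Forward: `2C ≥ 1`, so the descent gives rate `≤ √ν ≤ C√ν`.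
Backward: iterate over the dyadic levels — for the fixed non-extending solution, rate `≤ 2ⁿ√ν`
implies rate `≤ √ν` by induction on `n` (halve at level `2ⁿ⁻¹ ≥ 1`), and every `C` lies below some
`2ⁿ`. Absorption certificates on `K_{2C} ∩ {‖U‖_∞ > C}` would land in exactly this shape.
[bookkeeping] -/
theorem typeICertificateLadder_descent_iff_halving :
    (∀ C : ℝ, 1 ≤ C → ∀ (ν T : ℝ), 0 < ν → 0 < T → ∀ (u : ℝ → EuclideanSpace ℝ (Fin 3) → EuclideanSpace ℝ (Fin 3)) (p : ℝ → EuclideanSpace ℝ (Fin 3) → ℝ), Literature.Analysis.FluidPDE.IsClassicalNSSolutionOn (Set.Ico 0 T) ν 0 u p → Literature.Analysis.FluidPDE.IsLerayHopfOn T ν 0 (u 0) u → Literature.Analysis.FluidPDE.HasRapidSpatialDecay (u 0) → (∀ᶠ t in 𝓝[<] T, ∀ x, Real.sqrt (T - t) * ‖u t x‖ ≤ C * Real.sqrt ν) → ¬ Literature.Analysis.FluidPDE.HasSmoothExtensionPast ν 0 u T → ∀ᶠ t in 𝓝[<] T, ∀ x, Real.sqrt (T - t) * ‖u t x‖ ≤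 Real.sqrt ν) ↔
    ∀ C : ℝ, 1 ≤ C → ∀ (ν T : ℝ), 0 < ν → 0 < T → ∀ (u : ℝ → EuclideanSpace ℝ (Fin 3) → EuclideanSpace ℝ (Fin 3)) (p : ℝ → EuclideanSpace ℝ (Fin 3) → ℝ), Literature.Analysis.FluidPDE.IsClassicalNSSolutionOn (Set.Ico 0 T) ν 0 u p → Literature.Analysis.FluidPDE.IsLerayHopfOn T ν 0 (u 0) u → Literature.Analysis.FluidPDE.HasRapidSpatialDecay (u 0) → (∀ᶠ t in 𝓝[<] T, ∀ x, Real.sqrt (T - t) * ‖u t x‖ ≤ 2 * C * Real.sqrt ν) → ¬ Literature.Analysis.FluidPDE.HasSmoothExtensionPast ν 0 u T → ∀ᶠ t in 𝓝[<] T, ∀ x, Real.sqrt (T - t) * ‖u t x‖ ≤ C * Real.sqrt ν := by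
  constructor
  · intro hD C hC ν T hν hT u p hcl hLH hdec hrate hne
    have h2C : (1 : ℝ) ≤ 2 * C := by linarith
    have hdesc := hD (2 * C) h2C ν T hν hT u p hcl hLH hdec hrate hne
    filter_upwards [hdesc] with t ht x
    exact (ht x).trans (le_mul_of_one_le_left (Real.sqrt_nonneg ν) hC)
  · intro hH C _ ν T hν hT u p hcl hLH hdec hrate hne
    -- iterate the halving over the dyadic levels `2ⁿ` for this fixed non-extending solution
    have key : ∀ n : ℕ, (∀ᶠ t in 𝓝[<] T, ∀ x, Real.sqrt (T - t) * ‖u t x‖ ≤ (2 : ℝ) ^ n * Real.sqrt ν) →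
        ∀ᶠ t in 𝓝[<] T, ∀ x, Real.sqrt (T - t) * ‖u t x‖ ≤ Real.sqrt ν := by
      intro n
      induction n with
      | zero =>
        intro h
        simpa only [pow_zero, one_mul] using h
      | succ n ih =>
        intro h
        refine ih (hH ((2 : ℝ) ^ n) (one_le_pow₀ one_le_two) ν T hν hT u p hcl hLH hdec ?_ hne)
        simpa only [pow_succ'] using h
    obtain ⟨n, hn⟩ : ∃ n : ℕ, C < (2 : ℝ) ^ n := pow_unbounded_of_one_lt C one_lt_two
    refine key n ?_
    filter_upwards [hrate] with t ht x
    exact (ht x).trans (mul_le_mul_of_nonneg_right hn.le (Real.sqrt_nonneg ν))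

end Summit.NavierStokesRegularity.NavierStokesRegularity.Theorems
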